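import Literature.MathematicalPhysics.QuantumFieldTheory.Balaban1983to89.B1TorusCubeLocality26
import Literature.MathematicalPhysics.QuantumFieldTheory.Balaban1983to89.B4Lemma22ReduceZero

/-!
# `Balaban1983to89.B1TorusCubeChart` — the DICTIONARY between a cube «□_j, a cube of the size 2M with center in Mj» of the
# (Higgs)₂,₃ torus `T_ε` ([Balaban1982Higgs1] (1.2); [Balaban1983RegularityDecay] §2 p. 575) and the box carrier
# `Π_μ[0, L^K·2M)` ⊂ ℤ^{d} of the cell's [B4] Lemma 2.2 lineage (`B4Lemma22ReduceZero.Box`): sites, lattice steps, `K`-blocks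
# and block corners, fields and their sup norms, and the support invariance of the cube operator of (2.20)

statement-level skeleton of published theorems with citation tags; proofs where landed; nothing here is a claim about the Yang–Mills mass gap

CITATION HEADER (lean-in-tree rule).  T. Bałaban, *(Higgs)₂,₃ quantum fields in a finite volume. I*, Commun. Math. Phys. **85**
(1982) 603–626 [Balaban1982Higgs1] ((1.2) p. 604 the torus, (1.17)–(1.20) p. 607 the blocks, (2.20) p. 610 the operator) and
T. Bałaban, *Regularity and decay of lattice Green's functions*, Commun. Math. Phys. **89** (1983) 571–597
[Balaban1983RegularityDecay] (§2 p. 575 the cubes; p. 584 the box «□ = {x ∈ ξZ^d : 0 ≤ x_μ ≤ M_μ}»).  Cell `lit-balaban` (HOME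
`run/shared/lean/pub/lit-balaban/`), Phase-2 proof seat **p35** gen 8 (unit `lit-balaban-p35`); SKELETON rows **B4.Def§2** /
**B4.Lem2.2** / **B4.Thm@573** (the identification needed to feed the box theorems of the Lemma-2.2 lineage into the torus
random walk `B1TorusCubeLocality26.norm_propagatorK_univ_le`).  USED BY NAME, never restated: the typer's `HiggsLattice`,
`HiggsAveraging.{blockIter, toFinest, shiftN}`, `HiggsCovariance.{covOpK, propagatorK}`, p15's `B2Ineq329ZeroAveraging.{val_blockIter,
sitesPerDir_zero_eq}`, b04's `B4Reflection242.{boxDom, blk}`, r01's `B4Lower18Regular.e1`, `B4Lemma22ReduceZero.Box`,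
`B4Lemma22Reduce231.supN`, this seat's `B1TorusCubeCover` / `B1TorusCubeLocality26`.

WHAT THIS FILE PROVES (kernel-checked, zero `sorry`; definitions with bodies + theorems; no `def … : Prop` fact).
* §1 `dd` (`d − 1`), `castD` (`Fin (dd+1) ≃ Fin d`), `vecT`.
* §2 `boxCoord` (box coordinates of a torus site relative to `□_j`): `chart_boxCoord`, `boxCoord_chart`, `inCube_iff_boxCoord_lt`.
* §3 `toT` (the chart on the lineage's index type), `fromT`; `toT_fromT`, `fromT_toT`, `toT_add_e1`/`toT_sub_e1`/`toT_add_nsmul`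
  (lattice steps), `mem_cube_iff`, `toT_mem_cube`, `add_e1_mem_box_iff`/`sub_e1_mem_box_iff` (neighbours: no wrap-around when
  `3M ≤ |T_ε|_μ`), `toT_injOn`.
* §4 `K`-BLOCKS: `blockIter_toT` (the `K`-block of a chart point), `blockIter_toT_eq_iff` (same torus block ⇔ same `blk`),
  `mem_cube_of_blockIter_eq` (`□_j` is a union of `K`-blocks), `toFinest_blockIter_toT` (block corners ↔ `cl`).
* §5 FIELDS: `pull` (a torus field read on the box), `siteNorm_pull`, `supN_pull_le`, `norm_le_supN_pull` (for cube-supported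
  fields the sup norms agree).
* §6 SUPPORT: `covOpK_cube_apply_eq_zero_of_not_mem`/`…_of_supported_off` (the cube operator of (2.20) preserves fields
  supported in / off `□_j`), **`propagatorK_cube_supported`** (`G_j` of a `□_j`-supported field is `□_j`-supported).
HONEST SCOPE.  Bookkeeping only; hypotheses `K ≤ K_P`, `K₀ ∣ M_P`, `3·M ≤ |T_ε|_μ` (at least three cubes per direction: the
cube and its neighbours do not wrap).  Unit `lit-balaban-p35` gen 8 (literature-prover-lit-balaban-p35-g8-0).
-/

open scoped BigOperators

noncomputable section

namespace Literature.MathematicalPhysics.QuantumFieldTheory.Balaban1983to89.B1TorusCubeChart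

open Literature.MathematicalPhysics.QuantumFieldTheory.Balaban1983to89.HiggsLattice
open Literature.MathematicalPhysics.QuantumFieldTheory.Balaban1983to89.HiggsAveraging
open Literature.MathematicalPhysics.QuantumFieldTheory.Balaban1983to89.HiggsCovariance
open Literature.MathematicalPhysics.QuantumFieldTheory.Balaban1983to89.HiggsCovariancePos
  (shift_unshift unshift_shift isUnit_covOpK covOpK_mul_propagatorK)
open Literature.MathematicalPhysics.QuantumFieldTheory.Balaban1983to89.B2Ineq329ZeroAveraging
  (val_blockIter sitesPerDir_zero_eq shiftN_apply_self shiftN_apply_ne)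
open Literature.MathematicalPhysics.QuantumFieldTheory.Balaban1983to89.B1TorusCubeCover
open Literature.MathematicalPhysics.QuantumFieldTheory.Balaban1983to89.B1TorusCubeLocality26
open Literature.MathematicalPhysics.QuantumFieldTheory.Balaban1983to89.B4GaugeCovariance (fld fld_apply)
open Literature.MathematicalPhysics.QuantumFieldTheory.Balaban1983to89.B4Reflection242 (boxDom mem_boxDom blk)
open Literature.MathematicalPhysics.QuantumFieldTheory.Balaban1983to89.B4Lower18Regular (e1 e1_apply_self e1_apply_ne)
open Literature.MathematicalPhysics.QuantumFieldTheory.Balaban1983to89.B4Lemma21Region (siteNorm)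
open Literature.MathematicalPhysics.QuantumFieldTheory.Balaban1983to89.B4Lemma22Reduce231 (supN le_supN supN_le supN_nonneg
  siteNorm_nonneg)
open Literature.MathematicalPhysics.QuantumFieldTheory.Balaban1983to89.B4Lemma22ReduceZero (Box)

variable {P : HiggsLattice.Params} {N : ℕ}

/-! ## §1 The dimension of the lineage: `d = dd + 1` -/

/-- The lineage's `d + 1` is the model's `d`: `dd = d − 1`. [cite: Balaban1982Higgs1, (1.2) p.604] -/
def dd (P : HiggsLattice.Params) : ℕ := P.d - 1

/-- `dd + 1 = d`. [cite: Balaban1982Higgs1, (1.2) p.604] -/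
theorem dd_succ (P : HiggsLattice.Params) : dd P + 1 = P.d := Nat.sub_add_cancel P.hd

/-- The identification of direction indices `Fin (dd + 1) ≃ Fin d`. [cite: Balaban1982Higgs1, (1.2) p.604] -/
def castD (P : HiggsLattice.Params) : Fin (dd P + 1) ≃ Fin P.d := finCongr (dd_succ P)

/-- `castD` preserves the numeric value. [cite: Balaban1982Higgs1, (1.2) p.604] -/
@[simp] theorem castD_val (i : Fin (dd P + 1)) : ((castD P i : Fin P.d) : ℕ) = i := by
  simp [castD]

/-- `castD.symm` preserves the numeric value. [cite: Balaban1982Higgs1, (1.2) p.604] -/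
@[simp] theorem castD_symm_val (μ : Fin P.d) : (((castD P).symm μ : Fin (dd P + 1)) : ℕ) = μ := by
  simp [castD]

/-- An integer vector indexed by `Fin (dd+1)`, read on `Fin d`. [cite: Balaban1982Higgs1, (1.2) p.604] -/
def vecT (y : Fin (dd P + 1) → ℤ) : Fin P.d → ℤ := fun μ => y ((castD P).symm μ)

/-- `vecT` at a cast index. [cite: Balaban1982Higgs1, (1.2) p.604] -/
@[simp] theorem vecT_castD (y : Fin (dd P + 1) → ℤ) (i : Fin (dd P + 1)) : vecT y (castD P i) = y i := by
  simp [vecT]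

/-- `vecT (y + e_i) = vecT y + δ_{castD i}`. [cite: Balaban1982Higgs1, (1.2) p.604] -/
theorem vecT_add_e1 (y : Fin (dd P + 1) → ℤ) (i : Fin (dd P + 1)) (μ : Fin P.d) :
    vecT (y + e1 i) μ = vecT y μ + if μ = castD P i then 1 else 0 := by
  unfold vecT
  rw [Pi.add_apply]
  by_cases h : μ = castD P i
  · subst h; simp
  · have : (castD P).symm μ ≠ i := fun h' => h (by rw [← h', Equiv.apply_symm_apply])
    rw [e1_apply_ne this, if_neg h]

/-- `vecT (y − e_i) = vecT y − δ_{castD i}`. [cite: Balaban1982Higgs1, (1.2) p.604] -/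
theorem vecT_sub_e1 (y : Fin (dd P + 1) → ℤ) (i : Fin (dd P + 1)) (μ : Fin P.d) :
    vecT (y - e1 i) μ = vecT y μ - if μ = castD P i then 1 else 0 := by
  have h := vecT_add_e1 (y - e1 i) i μ
  rw [sub_add_cancel] at h
  linarith

/-! ## §2 Box coordinates of a torus site relative to `□_j` -/

section Coord

variable (K K₀ : ℕ)

/-- The box coordinates of the torus site `x` relative to `□_j`: the representative in `[0, |T_ε|_μ)` of `x_μ − (Mj_μ − M)`.
[cite: Balaban1983RegularityDecay, §2 p.575] -/
def boxCoord (j : Lab P K K₀) (x : HiggsLattice.Site P 0) : Fin P.d → ℤ :=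
  fun μ => (((x μ - ((ctr K K₀ j μ - half P K K₀ : ℤ) : ZMod (P.sitesPerDir 0 μ))).val : ℕ) : ℤ)

variable {K K₀}

/-- The chart inverts the box coordinates: `chart_j(boxCoord_j x) = x`. [cite: Balaban1983RegularityDecay, §2 p.575] -/
theorem chart_boxCoord (j : Lab P K K₀) (x : HiggsLattice.Site P 0) : chart K K₀ j (boxCoord K K₀ j x) = x := by
  funext μ
  simp only [chart, boxCoord, Int.cast_add, Int.cast_sub, Int.cast_natCast, ZMod.natCast_zmod_val]
  abel

/-- Box coordinates are in `[0, |T_ε|_μ)`. [cite: Balaban1982Higgs1, (1.2) p.604] -/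
theorem boxCoord_nonneg (j : Lab P K K₀) (x : HiggsLattice.Site P 0) (μ : Fin P.d) : 0 ≤ boxCoord K K₀ j x μ := by
  unfold boxCoord; positivity

/-- Box coordinates are in `[0, |T_ε|_μ)`. [cite: Balaban1982Higgs1, (1.2) p.604] -/
theorem boxCoord_lt (j : Lab P K K₀) (x : HiggsLattice.Site P 0) (μ : Fin P.d) : boxCoord K K₀ j x μ < P.sitesPerDir 0 μ := by
  unfold boxCoord; exact_mod_cast ZMod.val_lt _

/-- The box coordinates of a chart point `chart_j y`, `0 ≤ y_μ < |T_ε|_μ`, are `y`. [cite: Balaban1983RegularityDecay, §2 p.575] -/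
theorem boxCoord_chart (j : Lab P K K₀) {y : Fin P.d → ℤ} (hy : ∀ μ, 0 ≤ y μ ∧ y μ < P.sitesPerDir 0 μ) :
    boxCoord K K₀ j (chart K K₀ j y) = y := by
  funext μ
  unfold boxCoord chart
  have e : (((ctr K K₀ j μ - half P K K₀ + y μ : ℤ)) : ZMod (P.sitesPerDir 0 μ))
      - ((ctr K K₀ j μ - half P K K₀ : ℤ) : ZMod (P.sitesPerDir 0 μ)) = ((y μ : ℤ) : ZMod (P.sitesPerDir 0 μ)) := by
    push_cast; ring
  rw [e, ZMod.val_intCast, Int.emod_eq_of_lt (hy μ).1 (hy μ).2]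

/-- `x ∈ □_j` iff all its box coordinates are `< 2M`. [cite: Balaban1983RegularityDecay, §2 p.575] -/
theorem inCube_iff_boxCoord_lt (hK : K ≤ P.K) (hK₀ : K₀ ∣ P.M) (hK₀' : 1 ≤ K₀) (j : Lab P K K₀) (x : HiggsLattice.Site P 0) :
    InCube K K₀ j x ↔ ∀ μ, boxCoord K K₀ j x μ < 2 * half P K K₀ := by
  rw [inCube_iff_exists_chart]
  constructor
  · rintro ⟨y, hy, rfl⟩ μ
    have h2 : 2 * (half P K K₀ : ℤ) ≤ P.sitesPerDir 0 μ := by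
      have e := nLab_mul_half hK hK₀ μ
      have h2 := two_le_nLab hK hK₀ hK₀' μ
      have : 2 * half P K K₀ ≤ P.sitesPerDir 0 μ := by rw [← e]; exact Nat.mul_le_mul_right _ h2
      exact_mod_cast this
    rw [boxCoord_chart j (fun ν => ⟨(hy ν).1, ?_⟩)]
    · exact (hy μ).2
    · have e := nLab_mul_half hK hK₀ ν
      have h2' := two_le_nLab hK hK₀ hK₀' ν
      have : 2 * half P K K₀ ≤ P.sitesPerDir 0 ν := by rw [← e]; exact Nat.mul_le_mul_right _ h2'
      have := (hy ν).2
      have : (2 * half P K K₀ : ℕ) ≤ (P.sitesPerDir 0 ν : ℤ) := by exact_mod_cast (by assumption : 2 * half P K K₀ ≤ _)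
      push_cast at this
      omega
  · intro h
    exact ⟨boxCoord K K₀ j x, fun μ => ⟨boxCoord_nonneg j x μ, h μ⟩, (chart_boxCoord j x).symm⟩

end Coord

/-! ## §3 The chart on the lineage's index type, lattice steps, membership -/

section Chart

variable (K K₀ : ℕ)

/-- The fine-lattice refinement `n = L^K` of the lineage at level `K`. [cite: Balaban1982Higgs1, (1.19) p.607] -/
abbrev nK (P : HiggsLattice.Params) (K : ℕ) : ℕ := P.L ^ K

/-- The box sides of the lineage for a cube: `M_μ = 2M` large blocks (`K₀` = the print's `M` in unit blocks).
[cite: Balaban1983RegularityDecay, §2 p.575] -/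
def M2 (P : HiggsLattice.Params) (K₀ : ℕ) : Fin (dd P + 1) → ℕ := fun _ => 2 * K₀

/-- THE CHART `□ → □_j ⊂ T_ε` on the lineage's coordinates: `y ↦ Mj − M + y`. [cite: Balaban1983RegularityDecay, §2 p.575] -/
def toT (j : Lab P K K₀) (y : Fin (dd P + 1) → ℤ) : HiggsLattice.Site P 0 := chart K K₀ j (vecT y)

/-- Its inverse on `□_j`: the box coordinates on the lineage's index type. [cite: Balaban1983RegularityDecay, §2 p.575] -/
def fromT (j : Lab P K K₀) (x : HiggsLattice.Site P 0) : Fin (dd P + 1) → ℤ := fun i => boxCoord K K₀ j x (castD P i)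

variable {K K₀}

/-- `(L − 1) + 1 = L`, so the lineage's `(ℓ+1)^K` is `L^K`. [cite: Balaban1982Higgs1, (1.2) p.604] -/
theorem predL_succ (P : HiggsLattice.Params) : P.L - 1 + 1 = P.L := Nat.sub_add_cancel P.hL

/-- Membership in the lineage's box `Π[0, L^K·2M)`. [cite: Balaban1983RegularityDecay, p.584] -/
theorem mem_box_iff (y : Fin (dd P + 1) → ℤ) :
    y ∈ Box (dd P) (P.L - 1) K (M2 P K₀) ↔ ∀ i, 0 ≤ y i ∧ y i < 2 * half P K K₀ := by
  rw [mem_boxDom]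
  simp only [M2, predL_succ, half]
  push_cast
  constructor
  · intro h i; have := h i; constructor <;> nlinarith [this.1, this.2]
  · intro h i; have := h i; constructor <;> nlinarith [this.1, this.2]

/-- `toT ∘ fromT = id`. [cite: Balaban1983RegularityDecay, §2 p.575] -/
theorem toT_fromT (j : Lab P K K₀) (x : HiggsLattice.Site P 0) : toT K K₀ j (fromT K K₀ j x) = x := by
  unfold toT fromT
  have : vecT (fun i => boxCoord K K₀ j x (castD P i)) = boxCoord K K₀ j x := by
    funext μ; simp [vecT]
  rw [this, chart_boxCoord]

/-- `fromT ∘ toT = id` on vectors with coordinates in `[0, |T_ε|_μ)`. [cite: Balaban1983RegularityDecay, §2 p.575] -/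
theorem fromT_toT (j : Lab P K K₀) {y : Fin (dd P + 1) → ℤ} (hy : ∀ i, 0 ≤ y i ∧ y i < P.sitesPerDir 0 (castD P i)) :
    fromT K K₀ j (toT K K₀ j y) = y := by
  unfold toT fromT
  have hy' : ∀ μ, 0 ≤ vecT y μ ∧ vecT y μ < P.sitesPerDir 0 μ := by
    intro μ
    have := hy ((castD P).symm μ)
    rw [Equiv.apply_symm_apply] at this
    exact this
  funext i
  rw [boxCoord_chart j hy', vecT_castD]

/-- `2M ≤ |T_ε|_μ` (at least two cubes per direction). [cite: Balaban1982Higgs1, (1.2) p.604] -/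
theorem two_half_le_sites (hK : K ≤ P.K) (hK₀ : K₀ ∣ P.M) (hK₀' : 1 ≤ K₀) (μ : Fin P.d) :
    2 * (half P K K₀ : ℤ) ≤ P.sitesPerDir 0 μ := by
  have e := nLab_mul_half hK hK₀ μ
  have h2 := two_le_nLab hK hK₀ hK₀' μ
  have : 2 * half P K K₀ ≤ P.sitesPerDir 0 μ := by rw [← e]; exact Nat.mul_le_mul_right _ h2
  exact_mod_cast this

/-- Box points pull back to themselves. [cite: Balaban1983RegularityDecay, §2 p.575] -/
theorem fromT_toT_of_mem (hK : K ≤ P.K) (hK₀ : K₀ ∣ P.M) (hK₀' : 1 ≤ K₀) (j : Lab P K K₀) {y : Fin (dd P + 1) → ℤ}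
    (hy : y ∈ Box (dd P) (P.L - 1) K (M2 P K₀)) : fromT K K₀ j (toT K K₀ j y) = y := by
  rw [mem_box_iff] at hy
  exact fromT_toT j fun i => ⟨(hy i).1, lt_of_lt_of_le (hy i).2 (two_half_le_sites hK hK₀ hK₀' _)⟩

/-- `x ∈ □_j ⇔ fromT x ∈ □` (the chart is onto the cube). [cite: Balaban1983RegularityDecay, §2 p.575] -/
theorem mem_cube_iff (hK : K ≤ P.K) (hK₀ : K₀ ∣ P.M) (hK₀' : 1 ≤ K₀) (j : Lab P K K₀) (x : HiggsLattice.Site P 0) :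
    x ∈ cube K K₀ j ↔ fromT K K₀ j x ∈ Box (dd P) (P.L - 1) K (M2 P K₀) := by
  rw [mem_cube, inCube_iff_boxCoord_lt hK hK₀ hK₀', mem_box_iff]
  constructor
  · intro h i; exact ⟨boxCoord_nonneg j x _, h _⟩
  · intro h μ
    have := (h ((castD P).symm μ)).2
    unfold fromT at this
    rwa [Equiv.apply_symm_apply] at this

/-- Box points map into the cube. [cite: Balaban1983RegularityDecay, §2 p.575] -/
theorem toT_mem_cube (hK : K ≤ P.K) (hK₀ : K₀ ∣ P.M) (hK₀' : 1 ≤ K₀) (j : Lab P K K₀) {y : Fin (dd P + 1) → ℤ}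
    (hy : y ∈ Box (dd P) (P.L - 1) K (M2 P K₀)) : toT K K₀ j y ∈ cube K K₀ j := by
  rw [mem_cube_iff hK hK₀ hK₀', fromT_toT_of_mem hK hK₀ hK₀' j hy]
  exact hy

/-- **Lattice steps**: `toT (y + e_i) = toT y + εe_{castD i}`. [cite: Balaban1982Higgs1, (1.2) p.604] -/
theorem toT_add_e1 (j : Lab P K K₀) (y : Fin (dd P + 1) → ℤ) (i : Fin (dd P + 1)) :
    toT K K₀ j (y + e1 i) = (toT K K₀ j y).shift (castD P i) := by
  funext μ
  unfold toT chart HiggsLattice.Site.shift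
  rw [vecT_add_e1]
  by_cases h : μ = castD P i
  · subst h; simp only [if_true, Function.update_self]; push_cast; ring
  · rw [if_neg h, Function.update_of_ne h, add_zero]

/-- `toT (y − e_i) = toT y − εe_{castD i}`. [cite: Balaban1982Higgs1, (1.2) p.604] -/
theorem toT_sub_e1 (j : Lab P K K₀) (y : Fin (dd P + 1) → ℤ) (i : Fin (dd P + 1)) :
    toT K K₀ j (y - e1 i) = (toT K K₀ j y).unshift (castD P i) := by
  funext μ
  unfold toT chart HiggsLattice.Site.unshift
  rw [vecT_sub_e1]
  by_cases h : μ = castD P i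
  · subst h; simp only [if_true, Function.update_self]; push_cast; ring
  · rw [if_neg h, Function.update_of_ne h, sub_zero]

/-- `toT (y + s·e_i) = toT y + sεe_{castD i}`. [cite: Balaban1982Higgs1, (2.1) p.608] -/
theorem toT_add_nsmul (j : Lab P K K₀) (y : Fin (dd P + 1) → ℤ) (i : Fin (dd P + 1)) (s : ℕ) :
    toT K K₀ j (y + s • e1 i) = shiftN (toT K K₀ j y) (castD P i) s := by
  funext μ
  unfold toT chart shiftN vecT
  by_cases h : μ = castD P i
  · subst h
    rw [Function.update_self]
    simp only [Pi.add_apply, Pi.smul_apply, Equiv.symm_apply_apply, e1_apply_self]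
    simp only [Int.cast_add, Int.cast_sub, Int.cast_natCast, nsmul_eq_mul, mul_one]
    ring
  · rw [Function.update_of_ne h]
    have : (castD P).symm μ ≠ i := fun h' => h (by rw [← h', Equiv.apply_symm_apply])
    simp only [Pi.add_apply, Pi.smul_apply, e1_apply_ne this, smul_zero, add_zero]

/-- The chart is injective on vectors with coordinates in `[−1, 2M]` when `3M ≤ |T_ε|_μ` (`M ≥ 2`).
[cite: Balaban1983RegularityDecay, §2 p.575] -/
theorem toT_injOn (hN3 : ∀ μ, 3 * half P K K₀ ≤ P.sitesPerDir 0 μ) (hh2 : 2 ≤ half P K K₀) (j : Lab P K K₀)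
    {y y' : Fin (dd P + 1) → ℤ} (hy : ∀ i, -1 ≤ y i ∧ y i ≤ 2 * half P K K₀)
    (hy' : ∀ i, -1 ≤ y' i ∧ y' i ≤ 2 * half P K K₀) (h : toT K K₀ j y = toT K K₀ j y') : y = y' := by
  funext i
  have e := congrFun h (castD P i)
  unfold toT chart at e
  rw [vecT_castD, vecT_castD] at e
  change (((ctr K K₀ j (castD P i) - half P K K₀ + y i : ℤ)) : ZMod (P.sitesPerDir 0 (castD P i)))
    = (((ctr K K₀ j (castD P i) - half P K K₀ + y' i : ℤ)) : ZMod (P.sitesPerDir 0 (castD P i))) at e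
  rw [ZMod.intCast_eq_intCast_iff_dvd_sub] at e
  have hS : 3 * (half P K K₀ : ℤ) ≤ P.sitesPerDir 0 (castD P i) := by exact_mod_cast hN3 _
  have hsmall : ((ctr K K₀ j (castD P i) - half P K K₀ + y' i) - (ctr K K₀ j (castD P i) - half P K K₀ + y i)).natAbs
      < ((P.sitesPerDir 0 (castD P i) : ℕ) : ℤ).natAbs := by
    have h1 := hy i; have h2 := hy' i
    have hh2' : (2 : ℤ) ≤ half P K K₀ := by exact_mod_cast hh2
    omega
  have := Int.eq_zero_of_dvd_of_natAbs_lt_natAbs e hsmall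
  omega

/-- **No wrap-around**: for `y ∈ □`, `y + e_i ∈ □ ⇔ toT y + εe_i ∈ □_j` (`3M ≤ |T_ε|_μ`).
[cite: Balaban1983RegularityDecay, §2 p.575] -/
theorem add_e1_mem_box_iff (hK : K ≤ P.K) (hK₀ : K₀ ∣ P.M) (hK₀' : 1 ≤ K₀)
    (hN3 : ∀ μ, 3 * half P K K₀ ≤ P.sitesPerDir 0 μ) (hh2 : 2 ≤ half P K K₀) (j : Lab P K K₀)
    {y : Fin (dd P + 1) → ℤ} (hy : y ∈ Box (dd P) (P.L - 1) K (M2 P K₀)) (i : Fin (dd P + 1)) :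
    y + e1 i ∈ Box (dd P) (P.L - 1) K (M2 P K₀) ↔ (toT K K₀ j y).shift (castD P i) ∈ cube K K₀ j := by
  rw [← toT_add_e1]
  constructor
  · exact toT_mem_cube hK hK₀ hK₀' j
  · intro h
    rw [mem_cube_iff hK hK₀ hK₀'] at h
    have e : toT K K₀ j (fromT K K₀ j (toT K K₀ j (y + e1 i))) = toT K K₀ j (y + e1 i) := toT_fromT j _
    rw [mem_box_iff] at hy h ⊢
    have hyy := toT_injOn hN3 hh2 j (y := fromT K K₀ j (toT K K₀ j (y + e1 i))) (y' := y + e1 i)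
      (fun i' => ⟨by linarith [(h i').1], (h i').2.le⟩) (fun i' => ?_) e
    · intro i'; rw [← hyy]; exact h i'
    · rw [Pi.add_apply]
      by_cases hi : i' = i
      · subst hi; rw [e1_apply_self]; constructor <;> linarith [(hy i').1, (hy i').2]
      · rw [e1_apply_ne hi]; constructor <;> linarith [(hy i').1, (hy i').2]

/-- **No wrap-around**: for `y ∈ □`, `y − e_i ∈ □ ⇔ toT y − εe_i ∈ □_j` (`3M ≤ |T_ε|_μ`).
[cite: Balaban1983RegularityDecay, §2 p.575] -/
theorem sub_e1_mem_box_iff (hK : K ≤ P.K) (hK₀ : K₀ ∣ P.M) (hK₀' : 1 ≤ K₀)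
    (hN3 : ∀ μ, 3 * half P K K₀ ≤ P.sitesPerDir 0 μ) (hh2 : 2 ≤ half P K K₀) (j : Lab P K K₀)
    {y : Fin (dd P + 1) → ℤ} (hy : y ∈ Box (dd P) (P.L - 1) K (M2 P K₀)) (i : Fin (dd P + 1)) :
    y - e1 i ∈ Box (dd P) (P.L - 1) K (M2 P K₀) ↔ (toT K K₀ j y).unshift (castD P i) ∈ cube K K₀ j := by
  rw [← toT_sub_e1]
  constructor
  · exact toT_mem_cube hK hK₀ hK₀' j
  · intro h
    rw [mem_cube_iff hK hK₀ hK₀'] at h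
    have e : toT K K₀ j (fromT K K₀ j (toT K K₀ j (y - e1 i))) = toT K K₀ j (y - e1 i) := toT_fromT j _
    rw [mem_box_iff] at hy h ⊢
    have hyy := toT_injOn hN3 hh2 j (y := fromT K K₀ j (toT K K₀ j (y - e1 i))) (y' := y - e1 i)
      (fun i' => ⟨by linarith [(h i').1], (h i').2.le⟩) (fun i' => ?_) e
    · intro i'; rw [← hyy]; exact h i'
    · rw [Pi.sub_apply]
      by_cases hi : i' = i
      · subst hi; rw [e1_apply_self]; constructor <;> linarith [(hy i').1, (hy i').2]
      · rw [e1_apply_ne hi]; constructor <;> linarith [(hy i').1, (hy i').2]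

end Chart

/-! ## §4 `K`-blocks under the chart -/

section Blocks

variable {K K₀ : ℕ}

/-- The chart offset `Mj_μ − M = L^K·K₀·(j_μ − 1)` is a multiple of `L^i`, `i ≤ K`. [cite: Balaban1982Higgs1, (1.19) p.607] -/
theorem pow_dvd_offset {i : ℕ} (hi : i ≤ K) (j : Lab P K K₀) (μ : Fin P.d) :
    ((P.L : ℤ) ^ i) ∣ (ctr K K₀ j μ - half P K K₀) := by
  unfold ctr half
  push_cast
  have : ((P.L : ℤ) ^ i) ∣ (P.L : ℤ) ^ K := pow_dvd_pow _ hi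
  exact Dvd.dvd.sub (Dvd.dvd.mul_right (Dvd.dvd.mul_right this _) _) (Dvd.dvd.mul_right this _)

/-- `L^i` divides the torus side `|T_ε|_μ` for `i ≤ K_P`. [cite: Balaban1982Higgs1, (1.19) p.607] -/
theorem pow_dvd_sites {i : ℕ} (hi : i ≤ P.K) (μ : Fin P.d) : ((P.L : ℤ) ^ i) ∣ (P.sitesPerDir 0 μ : ℤ) := by
  rw [sitesPerDir_zero_eq hi μ]; push_cast; exact Dvd.intro _ rfl

/-- **The value of a chart coordinate modulo a multiple of `L^i`**: `val(toT y)_μ ≡ (Mj_μ − M) + y` (mod `|T_ε|_μ`).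
[cite: Balaban1982Higgs1, (1.2) p.604] -/
theorem val_toT_modEq (j : Lab P K K₀) (y : Fin (dd P + 1) → ℤ) (μ : Fin P.d) :
    ((((toT K K₀ j y) μ).val : ℕ) : ℤ) ≡ ctr K K₀ j μ - half P K K₀ + vecT y μ [ZMOD (P.sitesPerDir 0 μ)] := by
  unfold toT chart
  rw [ZMod.val_intCast]
  exact Int.mod_modEq _ _

/-- Floor division passes to residues: `n ∣ S`, `a ≡ b (mod S)` ⇒ `a/n ≡ b/n (mod S/n)` for the representative `a ∈ [0,S)`…
here in the form needed: `(a mod S)/n ≡ a/n (mod S/n)`. [folklore] -/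
private theorem emod_ediv_modEq {a S n : ℤ} (hn : 0 < n) (hS : n ∣ S) : (a % S) / n ≡ a / n [ZMOD (S / n)] := by
  obtain ⟨c, rfl⟩ := hS
  have e : a % (n * c) = a - (n * c) * (a / (n * c)) := by rw [Int.emod_def]
  rw [e, Int.mul_ediv_cancel_left _ hn.ne', Int.modEq_iff_dvd]
  have : (a - n * c * (a / (n * c))) / n = a / n - c * (a / (n * c)) := by
    rw [show a - n * c * (a / (n * c)) = a + n * (-(c * (a / (n * c)))) by ring, Int.add_mul_ediv_left _ _ hn.ne']
    ring
  rw [this]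
  exact ⟨a / (n * c), by ring⟩

/-- **THE `i`-BLOCK OF A CHART POINT**: `(toT y)_i = ((Mj − M)/Lⁱ + ⌊y/Lⁱ⌋) mod |T^{(i)}|` coordinatewise (`i ≤ K ≤ K_P`).
[cite: Balaban1982Higgs1, (1.20) p.607] -/
theorem blockIter_toT (hK : K ≤ P.K) {i : ℕ} (hi : i ≤ K) (j : Lab P K K₀) (y : Fin (dd P + 1) → ℤ) (μ : Fin P.d) :
    (blockIter i (toT K K₀ j y)) μ
      = (((ctr K K₀ j μ - half P K K₀) / (P.L : ℤ) ^ i + vecT y μ / (P.L : ℤ) ^ i : ℤ) : ZMod (P.sitesPerDir i μ)) := by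
  have hiK : i ≤ P.K := hi.trans hK
  have hL : (0 : ℤ) < (P.L : ℤ) ^ i := by have := P.hL; positivity
  have hv : ((blockIter i (toT K K₀ j y)) μ).val = ((toT K K₀ j y) μ).val / P.L ^ i := val_blockIter hiK _ μ
  rw [← ZMod.natCast_zmod_val ((blockIter i (toT K K₀ j y)) μ), hv, ← Int.cast_natCast,
    ZMod.intCast_eq_intCast_iff, Int.natCast_div, Nat.cast_pow]
  have hval : ((((toT K K₀ j y) μ).val : ℕ) : ℤ)
      = (ctr K K₀ j μ - half P K K₀ + vecT y μ) % (P.sitesPerDir 0 μ : ℤ) := by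
    unfold toT chart; rw [ZMod.val_intCast]
  have hS : ((P.sitesPerDir i μ : ℕ) : ℤ) = (P.sitesPerDir 0 μ : ℤ) / (P.L : ℤ) ^ i := by
    rw [sitesPerDir_zero_eq hiK μ]; push_cast; rw [Int.mul_ediv_cancel_left _ hL.ne']
  rw [hval, hS, ← Int.add_ediv_of_dvd_left (pow_dvd_offset hi j μ)]
  exact emod_ediv_modEq hL (pow_dvd_sites hiK μ)

/-- `3M ≤ |T_ε|_μ` gives `3K₀ ≤ |T^{(K)}|_μ`. [cite: Balaban1982Higgs1, (1.20) p.607] -/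
theorem three_K₀_le_sitesK (hK : K ≤ P.K) (hN3 : ∀ μ, 3 * half P K K₀ ≤ P.sitesPerDir 0 μ) (μ : Fin P.d) :
    3 * (K₀ : ℤ) ≤ P.sitesPerDir K μ := by
  have e := sitesPerDir_zero_eq hK μ
  have h := hN3 μ
  unfold half at h
  rw [e] at h
  have hL : 0 < P.L ^ K := pow_pos P.hL K
  have : 3 * K₀ ≤ P.sitesPerDir K μ := by
    have h' : P.L ^ K * (3 * K₀) ≤ P.L ^ K * P.sitesPerDir K μ := by
      calc P.L ^ K * (3 * K₀) = 3 * (P.L ^ K * K₀) := by ring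
        _ ≤ _ := h
    exact Nat.le_of_mul_le_mul_left h' hL
  exact_mod_cast this

/-- Block indices of box points lie in `[0, 2K₀)`. [cite: Balaban1983RegularityDecay, p.584] -/
theorem ediv_mem_of_mem_box {y : Fin (dd P + 1) → ℤ} (hy : y ∈ Box (dd P) (P.L - 1) K (M2 P K₀)) (i : Fin (dd P + 1)) :
    0 ≤ y i / (P.L : ℤ) ^ K ∧ y i / (P.L : ℤ) ^ K < 2 * K₀ := by
  rw [mem_box_iff] at hy
  have hL : (0 : ℤ) < (P.L : ℤ) ^ K := by have := P.hL; positivity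
  refine ⟨Int.ediv_nonneg (hy i).1 hL.le, ?_⟩
  rw [Int.ediv_lt_iff_lt_mul hL]
  have := (hy i).2; unfold half at this; push_cast at this; linarith

/-- **SAME TORUS BLOCK ⇔ SAME BOX BLOCK**: for `y, y′ ∈ □`, `(toT y)_K = (toT y′)_K ⇔ blk_{L^K} y = blk_{L^K} y′`
(`3M ≤ |T_ε|_μ`). [cite: Balaban1982Higgs1, (1.20) p.607] -/
theorem blockIter_toT_eq_iff (hK : K ≤ P.K) (hN3 : ∀ μ, 3 * half P K K₀ ≤ P.sitesPerDir 0 μ) (j : Lab P K K₀)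
    {y y' : Fin (dd P + 1) → ℤ} (hy : y ∈ Box (dd P) (P.L - 1) K (M2 P K₀))
    (hy' : y' ∈ Box (dd P) (P.L - 1) K (M2 P K₀)) :
    blockIter K (toT K K₀ j y) = blockIter K (toT K K₀ j y') ↔ blk (nK P K) y = blk (nK P K) y' := by
  constructor
  · intro h
    funext i
    have e := congrFun h (castD P i)
    rw [blockIter_toT hK le_rfl, blockIter_toT hK le_rfl, vecT_castD, vecT_castD,
      ZMod.intCast_eq_intCast_iff_dvd_sub] at e
    have h1 := ediv_mem_of_mem_box hy i
    have h2 := ediv_mem_of_mem_box hy' i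
    have h3 := three_K₀_le_sitesK hK hN3 (castD P i)
    have hsmall : ((ctr K K₀ j (castD P i) - half P K K₀) / (P.L : ℤ) ^ K + y' i / (P.L : ℤ) ^ K
        - ((ctr K K₀ j (castD P i) - half P K K₀) / (P.L : ℤ) ^ K + y i / (P.L : ℤ) ^ K)).natAbs
        < ((P.sitesPerDir K (castD P i) : ℕ) : ℤ).natAbs := by omega
    have := Int.eq_zero_of_dvd_of_natAbs_lt_natAbs e hsmall
    show y i / ((P.L ^ K : ℕ) : ℤ) = y' i / ((P.L ^ K : ℕ) : ℤ)
    push_cast; omega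
  · intro h
    funext μ
    have e : y ((castD P).symm μ) / (P.L : ℤ) ^ K = y' ((castD P).symm μ) / (P.L : ℤ) ^ K := by
      have := congrFun h ((castD P).symm μ)
      simp only [blk] at this; push_cast at this; exact this
    rw [blockIter_toT hK le_rfl, blockIter_toT hK le_rfl]
    unfold vecT
    rw [e]

/-- **`□_j` IS A UNION OF `K`-BLOCKS**: a torus site in the `K`-block of a point of `□_j` lies in `□_j` (`3M ≤ |T_ε|_μ`).
[cite: Balaban1983RegularityDecay, §2 p.575] -/
theorem mem_cube_of_blockIter_eq (hK : K ≤ P.K) (hK₀ : K₀ ∣ P.M) (hK₀' : 1 ≤ K₀)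
    (hN3 : ∀ μ, 3 * half P K K₀ ≤ P.sitesPerDir 0 μ) (j : Lab P K K₀) {x x' : HiggsLattice.Site P 0} (hx : x ∈ cube K K₀ j)
    (h : blockIter K x' = blockIter K x) : x' ∈ cube K K₀ j := by
  have hy := (mem_cube_iff hK hK₀ hK₀' j x).1 hx
  rw [mem_cube_iff hK hK₀ hK₀', mem_box_iff]
  intro i
  refine ⟨boxCoord_nonneg j x' _, ?_⟩
  have e := congrFun h (castD P i)
  rw [← toT_fromT (K := K) (K₀ := K₀) j x, ← toT_fromT (K := K) (K₀ := K₀) j x'] at e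
  rw [blockIter_toT hK le_rfl, blockIter_toT hK le_rfl, vecT_castD, vecT_castD,
    ZMod.intCast_eq_intCast_iff_dvd_sub] at e
  have hL : (0 : ℤ) < (P.L : ℤ) ^ K := by have := P.hL; positivity
  have h1 := ediv_mem_of_mem_box hy i
  have h3 := three_K₀_le_sitesK hK hN3 (castD P i)
  -- the box coordinate of `x'` is in `[0, |T_ε|)`, so its block index is in `[0, |T^{(K)}|)`
  have h2 : 0 ≤ fromT K K₀ j x' i / (P.L : ℤ) ^ K ∧ fromT K K₀ j x' i / (P.L : ℤ) ^ K < P.sitesPerDir K (castD P i) := by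
    refine ⟨Int.ediv_nonneg (boxCoord_nonneg j x' _) hL.le, ?_⟩
    rw [Int.ediv_lt_iff_lt_mul hL]
    have := boxCoord_lt j x' (castD P i)
    have eS := sitesPerDir_zero_eq hK (castD P i)
    unfold fromT
    calc boxCoord K K₀ j x' (castD P i) < P.sitesPerDir 0 (castD P i) := this
      _ = P.sitesPerDir K (castD P i) * (P.L : ℤ) ^ K := by rw [eS]; push_cast; ring
  have hsmall : ((ctr K K₀ j (castD P i) - half P K K₀) / (P.L : ℤ) ^ K + fromT K K₀ j x i / (P.L : ℤ) ^ K
      - ((ctr K K₀ j (castD P i) - half P K K₀) / (P.L : ℤ) ^ K + fromT K K₀ j x' i / (P.L : ℤ) ^ K)).natAbs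
      < ((P.sitesPerDir K (castD P i) : ℕ) : ℤ).natAbs := by omega
  have h0 := Int.eq_zero_of_dvd_of_natAbs_lt_natAbs e hsmall
  have heq : fromT K K₀ j x' i / (P.L : ℤ) ^ K < 2 * K₀ := by omega
  rw [Int.ediv_lt_iff_lt_mul hL] at heq
  unfold half; push_cast; linarith

/-- **BLOCK CORNERS**: the fine representative of the `i`-block of `toT y` is the chart point of `Lⁱ⌊y/Lⁱ⌋` (`i ≤ K`).
[cite: Balaban1982Higgs1, (2.2) p.608] -/
theorem toFinest_blockIter_toT (hK : K ≤ P.K) {i : ℕ} (hi : i ≤ K) (j : Lab P K K₀) (y : Fin (dd P + 1) → ℤ) :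
    toFinest (blockIter i (toT K K₀ j y)) = toT K K₀ j (fun i' => (P.L : ℤ) ^ i * (y i' / (P.L : ℤ) ^ i)) := by
  have hiK : i ≤ P.K := hi.trans hK
  have hL : (0 : ℤ) < (P.L : ℤ) ^ i := by have := P.hL; positivity
  funext μ
  have hb := blockIter_toT hK hi j y μ
  set q : ℤ := (ctr K K₀ j μ - half P K K₀) / (P.L : ℤ) ^ i + vecT y μ / (P.L : ℤ) ^ i with hq
  have hval : ((((blockIter i (toT K K₀ j y)) μ).val : ℕ) : ℤ) = q % (P.sitesPerDir i μ : ℤ) := by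
    rw [hb, ZMod.val_intCast]
  have hr : toT K K₀ j (fun i' => (P.L : ℤ) ^ i * (y i' / (P.L : ℤ) ^ i)) μ
      = (((ctr K K₀ j μ - half P K K₀ + vecT (fun i' => (P.L : ℤ) ^ i * (y i' / (P.L : ℤ) ^ i)) μ : ℤ)) :
        ZMod (P.sitesPerDir 0 μ)) := rfl
  unfold toFinest
  rw [hr, ← Int.cast_natCast, Nat.cast_mul, hval, Nat.cast_pow, ZMod.intCast_eq_intCast_iff_dvd_sub]
  have hS : ((P.sitesPerDir 0 μ : ℕ) : ℤ) = (P.L : ℤ) ^ i * (P.sitesPerDir i μ : ℤ) := by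
    rw [sitesPerDir_zero_eq hiK μ]; push_cast; ring
  have hc : (ctr K K₀ j μ - half P K K₀) / (P.L : ℤ) ^ i * (P.L : ℤ) ^ i = ctr K K₀ j μ - half P K K₀ :=
    Int.ediv_mul_cancel (pow_dvd_offset hi j μ)
  have hvec : vecT (fun i' => (P.L : ℤ) ^ i * (y i' / (P.L : ℤ) ^ i)) μ = (P.L : ℤ) ^ i * (vecT y μ / (P.L : ℤ) ^ i) := rfl
  rw [hvec, hS, Int.emod_def]
  exact ⟨q / (P.sitesPerDir i μ : ℤ), by rw [hq]; linear_combination -hc⟩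

end Blocks

/-! ## §5 Fields: a torus field read on the box; sup norms -/

section Fields

variable (K K₀ : ℕ)

/-- A field on `T_ε` READ ON THE BOX: `(pull ψ)(y, i) = ψ(toT y)_i`. [cite: Balaban1983RegularityDecay, §2 p.575] -/
def pull (j : Lab P K K₀) (ψ : HiggsLattice.ScalarField P 0 N) : ↥(Box (dd P) (P.L - 1) K (M2 P K₀)) × Fin N → ℝ :=
  fun p => ψ (toT K K₀ j p.1.1) p.2

variable {K K₀}

/-- `pull` is additive. [cite: Balaban1983RegularityDecay, §2 p.575] -/
theorem pull_add (j : Lab P K K₀) (ψ φ : HiggsLattice.ScalarField P 0 N) : pull K K₀ j (ψ + φ) = pull K K₀ j ψ + pull K K₀ j φ := by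
  funext p; simp [pull]

/-- `pull` is homogeneous. [cite: Balaban1983RegularityDecay, §2 p.575] -/
theorem pull_smul (j : Lab P K K₀) (c : ℝ) (ψ : HiggsLattice.ScalarField P 0 N) : pull K K₀ j (c • ψ) = c • pull K K₀ j ψ := by
  funext p; simp [pull]

/-- `pull` of a sitewise product `h·ψ`. [cite: Balaban1983RegularityDecay, §2 p.575] -/
theorem pull_hsmul (j : Lab P K K₀) (h : HiggsLattice.Site P 0 → ℝ) (ψ : HiggsLattice.ScalarField P 0 N) (p) :
    pull K K₀ j (h • ψ) p = h (toT K K₀ j p.1.1) * pull K K₀ j ψ p := by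
  simp [pull]

/-- The colour vector of `pull ψ` at `y` is `ψ(toT y)`. [cite: Balaban1983RegularityDecay, §2 p.575] -/
theorem fld_pull (j : Lab P K K₀) (ψ : HiggsLattice.ScalarField P 0 N) (y : ↥(Box (dd P) (P.L - 1) K (M2 P K₀))) :
    fld (pull K K₀ j ψ) y = fun i => ψ (toT K K₀ j y.1) i := rfl

/-- The site norm of `pull ψ` at `y` is the Euclidean norm `|ψ(toT y)|`. [cite: Balaban1982Higgs1, (1.5) p.604] -/
theorem siteNorm_pull (j : Lab P K K₀) (ψ : HiggsLattice.ScalarField P 0 N) (y : ↥(Box (dd P) (P.L - 1) K (M2 P K₀))) :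
    siteNorm (fld (pull K K₀ j ψ) y) = ‖ψ (toT K K₀ j y.1)‖ := by
  rw [siteNorm, EuclideanSpace.norm_eq, fld_pull]
  congr 1
  simp only [dotProduct, Real.norm_eq_abs, sq, abs_mul_abs_self]

/-- `‖pull ψ‖_∞ ≤ ‖ψ‖_∞`. [cite: Balaban1983RegularityDecay, (2.17) p.578] -/
theorem supN_pull_le (j : Lab P K K₀) (ψ : HiggsLattice.ScalarField P 0 N) : supN (pull K K₀ j ψ) ≤ ‖ψ‖ :=
  supN_le (norm_nonneg _) fun y => by rw [siteNorm_pull]; exact norm_le_pi_norm ψ _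

/-- For a `□_j`-supported field `‖ψ‖_∞ ≤ ‖pull ψ‖_∞` (hence `=`). [cite: Balaban1983RegularityDecay, (2.17) p.578] -/
theorem norm_le_supN_pull (hK : K ≤ P.K) (hK₀ : K₀ ∣ P.M) (hK₀' : 1 ≤ K₀) (j : Lab P K K₀) {ψ : HiggsLattice.ScalarField P 0 N}
    (hψ : ∀ x, x ∉ cube K K₀ j → ψ x = 0) : ‖ψ‖ ≤ supN (pull K K₀ j ψ) := by
  refine (pi_norm_le_iff_of_nonneg (supN_nonneg _)).2 fun x => ?_
  by_cases hx : x ∈ cube K K₀ j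
  · have hy := (mem_cube_iff hK hK₀ hK₀' j x).1 hx
    have h := le_supN (pull K K₀ j ψ) ⟨fromT K K₀ j x, hy⟩
    rw [siteNorm_pull] at h
    simpa only [toT_fromT] using h
  · rw [hψ x hx, norm_zero]; exact supN_nonneg _

/-- For a `□_j`-supported field the two sup norms agree. [cite: Balaban1983RegularityDecay, (2.17) p.578] -/
theorem norm_eq_supN_pull (hK : K ≤ P.K) (hK₀ : K₀ ∣ P.M) (hK₀' : 1 ≤ K₀) (j : Lab P K K₀) {ψ : HiggsLattice.ScalarField P 0 N}
    (hψ : ∀ x, x ∉ cube K K₀ j → ψ x = 0) : ‖ψ‖ = supN (pull K K₀ j ψ) :=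
  le_antisymm (norm_le_supN_pull hK hK₀ hK₀' j hψ) (supN_pull_le j ψ)

end Fields

/-! ## §6 Support invariance of the cube operator of (2.20) and of `G_j` -/

section Support

variable {K K₀ : ℕ}

/-- **`H_j` maps fields supported OFF `□_j` to fields vanishing ON `□_j`** (`□_j` a union of `K`-blocks; Neumann bonds inside
`□_j` only). [cite: Balaban1982Higgs1, (2.20) p.610] -/
theorem covOpK_cube_apply_eq_zero_of_off (C : ChargeData N) (hK : K ≤ P.K) (hK₀ : K₀ ∣ P.M) (hK₀' : 1 ≤ K₀)
    (hN3 : ∀ μ, 3 * half P K K₀ ≤ P.sitesPerDir 0 μ) (j : Lab P K K₀) (A' : HiggsLattice.VecField P 0) (msq a : ℝ)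
    {φ : HiggsLattice.ScalarField P 0 N} (hφ : ∀ x, x ∈ cube K K₀ j → φ x = 0) {x : HiggsLattice.Site P 0} (hx : x ∈ cube K K₀ j) :
    covOpK C (cube K K₀ j) A' msq a K φ x = 0 := by
  simp only [covOpK, LinearMap.add_apply, LinearMap.smul_apply, LinearMap.id_apply, Pi.add_apply, Pi.smul_apply]
  have eL : covLaplacianN C (cube K K₀ j) A' φ x = 0 := by
    rw [covLaplacianN_apply]
    refine smul_eq_zero_of_right _ (Finset.sum_eq_zero fun μ _ => ?_)
    rw [fwdTerm_apply, bwdTerm_apply, hφ x hx]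
    have h1 : (x ∈ cube K K₀ j ∧ x.shift μ ∈ cube K K₀ j) → φ (x.shift μ) = 0 := fun h => hφ _ h.2
    have h2 : (x ∈ cube K K₀ j ∧ x.unshift μ ∈ cube K K₀ j) → φ (x.unshift μ) = 0 := fun h => hφ _ h.2
    split_ifs with ha hb hb
    · rw [h1 ha, h2 hb]; simp
    · rw [h1 ha]; simp
    · rw [h2 hb]; simp
    · simp
  have eP : projPk C A' K φ x = 0 := by
    rw [projPk_apply, Finset.sum_eq_zero fun x' hx' => by
      rw [mem_blockK] at hx'
      rw [hφ x' (mem_cube_of_blockIter_eq hK hK₀ hK₀' hN3 j hx hx'), map_zero]]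
    simp
  rw [eL, hφ x hx, eP, smul_zero, smul_zero, add_zero, add_zero]

/-- **`H_j` maps `□_j`-supported fields to `□_j`-supported fields**. [cite: Balaban1982Higgs1, (2.20) p.610] -/
theorem covOpK_cube_apply_eq_zero_of_in (C : ChargeData N) (hK : K ≤ P.K) (hK₀ : K₀ ∣ P.M) (hK₀' : 1 ≤ K₀)
    (hN3 : ∀ μ, 3 * half P K K₀ ≤ P.sitesPerDir 0 μ) (j : Lab P K K₀) (A' : HiggsLattice.VecField P 0) (msq a : ℝ)
    {φ : HiggsLattice.ScalarField P 0 N} (hφ : ∀ x, x ∉ cube K K₀ j → φ x = 0) {x : HiggsLattice.Site P 0} (hx : x ∉ cube K K₀ j) :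
    covOpK C (cube K K₀ j) A' msq a K φ x = 0 := by
  simp only [covOpK, LinearMap.add_apply, LinearMap.smul_apply, LinearMap.id_apply, Pi.add_apply, Pi.smul_apply]
  have eL : covLaplacianN C (cube K K₀ j) A' φ x = 0 := by
    rw [covLaplacianN_apply]
    refine smul_eq_zero_of_right _ (Finset.sum_eq_zero fun μ _ => ?_)
    rw [fwdTerm_apply, bwdTerm_apply, if_neg (fun h => hx h.1), if_neg (fun h => hx h.1), add_zero]
  have eP : projPk C A' K φ x = 0 := by
    rw [projPk_apply, Finset.sum_eq_zero fun x' hx' => by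
      rw [mem_blockK] at hx'
      rw [hφ x' (fun h' => hx (mem_cube_of_blockIter_eq hK hK₀ hK₀' hN3 j h' hx'.symm)), map_zero]]
    simp
  rw [eL, hφ x hx, eP, smul_zero, smul_zero, add_zero, add_zero]

/-- **`G_j = G^ε_K(□_j, ·)` OF A `□_j`-SUPPORTED FIELD IS `□_j`-SUPPORTED** (`m² > 0`, `a_K ≥ 0`): the operator of (2.20)
is block-diagonal for the splitting (fields on `□_j`) ⊕ (fields off `□_j`) and injective.
[cite: Balaban1982Higgs1, (2.20) p.610] -/
theorem propagatorK_cube_supported (C : ChargeData N) (hK : K ≤ P.K) (hK₀ : K₀ ∣ P.M) (hK₀' : 1 ≤ K₀)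
    (hN3 : ∀ μ, 3 * half P K K₀ ≤ P.sitesPerDir 0 μ) (j : Lab P K K₀) (A' : HiggsLattice.VecField P 0) {msq : ℝ}
    (hmsq : 0 < msq) (a : ℝ) (hak : 0 ≤ B1.aSeq a P.L K) {φ : HiggsLattice.ScalarField P 0 N}
    (hφ : ∀ x, x ∉ cube K K₀ j → φ x = 0) {x : HiggsLattice.Site P 0} (hx : x ∉ cube K K₀ j) :
    propagatorK C (cube K K₀ j) A' msq a K φ x = 0 := by
  classical
  set u := propagatorK C (cube K K₀ j) A' msq a K φ with hu
  set uin : HiggsLattice.ScalarField P 0 N := fun z => if z ∈ cube K K₀ j then u z else 0 with huin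
  set uout : HiggsLattice.ScalarField P 0 N := u - uin with huout
  have hin : ∀ z, z ∉ cube K K₀ j → uin z = 0 := fun z hz => by simp [huin, hz]
  have hout : ∀ z, z ∈ cube K K₀ j → uout z = 0 := fun z hz => by simp [huout, huin, hz]
  have hHu : covOpK C (cube K K₀ j) A' msq a K u = φ :=
    HiggsCovariancePos.covOpK_propagatorK_apply C _ A' hmsq a K hak φ
  have hzero : covOpK C (cube K K₀ j) A' msq a K uout = 0 := by
    funext z
    by_cases hz : z ∈ cube K K₀ j
    · exact covOpK_cube_apply_eq_zero_of_off C hK hK₀ hK₀' hN3 j A' msq a hout hz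
    · have e : covOpK C (cube K K₀ j) A' msq a K uout
          = covOpK C (cube K K₀ j) A' msq a K u - covOpK C (cube K K₀ j) A' msq a K uin := by
        rw [huout, map_sub]
      rw [e, Pi.sub_apply, hHu, hφ z hz, covOpK_cube_apply_eq_zero_of_in C hK hK₀ hK₀' hN3 j A' msq a hin hz,
        sub_zero, Pi.zero_apply]
  have huout0 : uout = 0 := by
    have := HiggsCovariancePos.covOpK_injective C (cube K K₀ j) A' hmsq a K hak
    exact this (by rw [hzero, map_zero])
  have : u = uin := by
    have := congrArg (fun w => w + uin) huout0
    simpa [huout] using this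
  rw [this]
  exact hin x hx

end Support

end Literature.MathematicalPhysics.QuantumFieldTheory.Balaban1983to89.B1TorusCubeChart
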